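import Summits.RiemannHypothesis.RiemannHypothesis.Theorems.MotivicDoorAWSStructure
import Literature.NumberTheory.LFunctions.WeilGroundEnergyProofs

/-!
# AWS sprint: the forcing lemma reduced to one continuity estimate

HONEST LABEL.  One-way implication from a strengthened, prime-side-only axiom system; the existence
of an `ArithmeticWeilSurface` is NOT claimed and is the located gap; the converse (RH ⇒ existence) is
NOT a harder statement: satisfiability of the axiom list is EQUIVALENT to RH — the canonical carrier
written down from prime-side data satisfies every axiom except `hodge`, and on it `hodge` IS Weil
positivity on a dense class — so the hypothesis is tautological rather than informative
(`AXIOM-CONTENT.md` §2, referee-signed 2026-08-19; kernel form `riemannHypothesis_iff_exists_tautologicalCarrier`,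
`Theorems/MotivicDoor/AWS/Tautological.lean`).  [Docstring corrected 2026-08-19T22:1xZ: the earlier clause
"not expected to be provable" was false for this axiom system, REFEREE-1 B39.]  Framing: lottery
ticket at the motivic door; RH probability negligible; consolation prizes are real: a new semi-local
Weil-positivity theorem, or a located gap in the Connes–Consani programme, plus the ff-door theorem.

This file carries the GENERATORS-UP half of the forcing lemma and the limit argument, so that the
whole sprint theorem `Nonempty ArithmeticWeilSurface → RiemannHypothesis` is reduced to the single
analytic continuity statement `CcDataContinuousOn R` (all `R > 0`; TEST-CLASS-DOWN, aws-3):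

* `weilQuadratic_scaled_test_nonneg` — `0 ≤ Re Q(N⁻¹ u_c)` for every rational multiple of an integer
  combination of the generators (Hodge index on the lattice, `weilQuadratic_test_nonneg`, and the
  homogeneity `Q(c g) = |c|² Q(g)`, `weilQuadratic_const_mul`);
* `ccPairing_le_masses_scaled_test` — the same in Castelnuovo–Severi form `2𝔰(f,f) ≤ 2 d⋆(f) d_u(f)`;
* `CcDataContinuous := ∀ R > 0, CcDataContinuousOn R` (the named target node for aws-3) and
  `weilPositivityForcing_of_continuity : CcDataContinuous → WeilPositivityForcing`
  — the limit argument through the density axiom `gen.dense`;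
* `riemannHypothesisOfAWS_of_continuity`, `riemannHypothesis_of_arithmeticWeilSurface_of_continuity`
  — hence `CcDataContinuous → Nonempty ArithmeticWeilSurface → RiemannHypothesis`.

No zeros of `ζ` are used as input anywhere; `RiemannHypothesis` enters only through the PROVED
`weil_criterion_holds` inside `forall_ccPairing_le_masses_iff_riemannHypothesis`.
-/

noncomputable section

open Complex Set MeasureTheory Literature.NumberTheory.LFunctions
open Literature.NumberTheory.ConnesConsani2019
open Summit.RiemannHypothesis.RiemannHypothesis.Theorems.MotivicDoor.ConnesConsani

namespace Summit.RiemannHypothesis.RiemannHypothesis.Theorems.MotivicDoor.AWS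

namespace ArithmeticWeilSurface

variable (X : ArithmeticWeilSurface)

/-- A real multiple of an integer combination of the generators is a (real) Weil test function. -/
theorem isWeilTest_const_mul_test (a : ℝ) (c : X.gen.ι →₀ ℤ) :
    IsWeilTest fun t ↦ ((a * X.test c t : ℝ) : ℂ) := by
  have h := (X.isWeilTest_test c).const_mul (a : ℂ)
  convert h using 1
  funext t
  push_cast
  ring

/-- The support of a real multiple of `u_c` lies in the support of `u_c`. -/
theorem tsupport_const_mul_test_subset (a : ℝ) (c : X.gen.ι →₀ ℤ) :
    tsupport (fun t ↦ a * X.test c t) ⊆ tsupport (X.test c) :=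
  tsupport_mul_subset_right

/-- **Weil positivity on rational (indeed real) multiples of the Frobenius span**:
`0 ≤ Re Q(a u_c)` — Hodge index on the lattice plus the homogeneity `Q(a g) = a² Q(g)`. -/
theorem weilQuadratic_scaled_test_nonneg (a : ℝ) (c : X.gen.ι →₀ ℤ) :
    0 ≤ (weilQuadratic fun t ↦ ((a * X.test c t : ℝ) : ℂ)).re := by
  have h0 := X.weilQuadratic_test_nonneg c
  have hfun : (fun t ↦ ((a * X.test c t : ℝ) : ℂ)) = fun t ↦ (a : ℂ) * (X.test c t : ℂ) := by
    funext t; push_cast; ring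
  rw [hfun, weilQuadratic_const_mul, Complex.re_ofReal_mul]
  exact mul_nonneg (Complex.normSq_nonneg _) h0

/-- The same in Castelnuovo–Severi form: `2𝔰(f,f) ≤ 2 (∫ f d*u)(∫ f du)` for `f = toMul (a u_c)`. -/
theorem ccPairing_le_masses_scaled_test (a : ℝ) (c : X.gen.ι →₀ ℤ) :
    2 * ccPairing (toMul fun t ↦ a * X.test c t) (toMul fun t ↦ a * X.test c t) ≤
      2 * (massDstar (toMul fun t ↦ a * X.test c t) * massDu (toMul fun t ↦ a * X.test c t)) :=
  (ccPairing_le_masses_iff (X.isWeilTest_const_mul_test a c)).mpr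
    (X.weilQuadratic_scaled_test_nonneg a c)

end ArithmeticWeilSurface

/-! ## The limit argument -/

/-- TARGET NODE (TEST-CLASS-DOWN, aws-3): window continuity of the prime-side data on every window
— `CcDataContinuousOn R` for all `R > 0`.  This is the single analytic input to which the sprint
theorem is reduced below. -/
@[conjecture] def CcDataContinuous : Prop := ∀ R : ℝ, 0 < R → CcDataContinuousOn R

/-- Elementary limit step: if for every `δ > 0` the numbers `s, A, B` are `δ`-close to numbers
`s', A', B'` with `s' ≤ A' B'`, then `s ≤ A B`. -/
theorem le_mul_of_forall_close {s A B : ℝ}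
    (h : ∀ δ : ℝ, 0 < δ → ∃ s' A' B' : ℝ,
      |s - s'| ≤ δ ∧ |A - A'| ≤ δ ∧ |B - B'| ≤ δ ∧ s' ≤ A' * B') :
    s ≤ A * B := by
  refine le_of_forall_pos_lt_add fun ε hε ↦ ?_
  set M : ℝ := 2 + |A| + |B| with hM
  have hMpos : 0 < M := by positivity
  set δ : ℝ := min 1 (ε / (2 * M)) with hδ
  have hδpos : 0 < δ := lt_min one_pos (by positivity)
  have hδ1 : δ ≤ 1 := min_le_left _ _
  have hδ2 : δ ≤ ε / (2 * M) := min_le_right _ _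
  obtain ⟨s', A', B', hs, hA, hB, hle⟩ := h δ hδpos
  have hs' : s ≤ s' + δ := by linarith [(abs_le.mp hs).2]
  -- `A' B' ≤ A B + δ (|A| + |B| + δ)`
  have hA' : |A' - A| ≤ δ := by rw [abs_sub_comm]; exact hA
  have hB' : |B' - B| ≤ δ := by rw [abs_sub_comm]; exact hB
  have hprod : A' * B' ≤ A * B + δ * (|A| + |B| + δ) := by
    have h1 : A' * B' - A * B = (A' - A) * B + A * (B' - B) + (A' - A) * (B' - B) := by ring
    have h2 : |A' * B' - A * B| ≤ δ * |B| + |A| * δ + δ * δ := by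
      rw [h1]
      calc |(A' - A) * B + A * (B' - B) + (A' - A) * (B' - B)|
          ≤ |(A' - A) * B| + |A * (B' - B)| + |(A' - A) * (B' - B)| := abs_add_three _ _ _
        _ = |A' - A| * |B| + |A| * |B' - B| + |A' - A| * |B' - B| := by
          rw [abs_mul, abs_mul, abs_mul]
        _ ≤ δ * |B| + |A| * δ + δ * δ := by
          gcongr
    have h3 := (abs_le.mp h2).2
    nlinarith [h3]
  have hδM : δ * (1 + |A| + |B| + δ) ≤ ε / 2 := by
    calc δ * (1 + |A| + |B| + δ) ≤ δ * M := by
          apply mul_le_mul_of_nonneg_left _ hδpos.le; rw [hM]; linarith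
      _ ≤ ε / (2 * M) * M := by gcongr
      _ = ε / 2 := by field_simp
  calc s ≤ s' + δ := hs'
    _ ≤ A' * B' + δ := by linarith
    _ ≤ A * B + δ * (|A| + |B| + δ) + δ := by linarith
    _ = A * B + δ * (1 + |A| + |B| + δ) := by ring
    _ ≤ A * B + ε / 2 := by linarith
    _ < A * B + ε := by linarith

/-- **GENERATORS-UP + LIMIT: the forcing lemma follows from the window continuity of the prime-side
data.**  For a real test function `u`, the density axiom `X.gen.dense` supplies, on a fixed window
`[-R, R]`, rational multiples `N⁻¹ u_c` of integer combinations of the generators `C¹`-close to `u`;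
each satisfies Castelnuovo–Severi (`ccPairing_le_masses_scaled_test`, from the Hodge-index field);
`CcDataContinuousOn R` passes the inequality to the limit. -/
theorem weilPositivityForcing_of_continuity (hC : CcDataContinuous) :
    WeilPositivityForcing := by
  intro X u hu
  obtain ⟨R, hR, hsuppu, hdense⟩ := X.gen.dense u hu
  have hcont := hC R hR u hu hsuppu
  suffices h : ccPairing (toMul u) (toMul u) ≤ massDstar (toMul u) * massDu (toMul u) by linarith
  refine le_mul_of_forall_close fun δ hδ ↦ ?_
  obtain ⟨ε, hε, hclose⟩ := hcont δ hδ
  obtain ⟨N, c, hN, hsuppc, hval, hder⟩ := hdense ε hε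
  set v : ℝ → ℝ := fun t ↦ (N : ℝ)⁻¹ * testCombination X.gen.φ c t with hv
  have hvtest : IsWeilTest fun t ↦ (v t : ℂ) := X.isWeilTest_const_mul_test (N : ℝ)⁻¹ c
  have hsuppv : tsupport v ⊆ Icc (-R) R :=
    (X.tsupport_const_mul_test_subset (N : ℝ)⁻¹ c).trans hsuppc
  obtain ⟨hs, hA, hB⟩ := hclose v hvtest hsuppv hval hder
  refine ⟨ccPairing (toMul v) (toMul v), massDstar (toMul v), massDu (toMul v), hs, hA, hB, ?_⟩
  have hcs := X.ccPairing_le_masses_scaled_test (N : ℝ)⁻¹ c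
  change 2 * ccPairing (toMul v) (toMul v) ≤ 2 * (massDstar (toMul v) * massDu (toMul v)) at hcs
  linarith

/-- **The sprint theorem, reduced to the one continuity estimate**:
`(∀ R > 0, CcDataContinuousOn R) → (Nonempty ArithmeticWeilSurface → RiemannHypothesis)`. -/
theorem riemannHypothesisOfAWS_of_continuity (hC : CcDataContinuous) :
    RiemannHypothesisOfArithmeticWeilSurface :=
  riemannHypothesisOfAWS_of_forcing (weilPositivityForcing_of_continuity hC)

/-- The same with the surface explicit. -/
theorem riemannHypothesis_of_arithmeticWeilSurface_of_continuity
    (hC : CcDataContinuous) (X : ArithmeticWeilSurface) :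
    _root_.RiemannHypothesis :=
  riemannHypothesisOfAWS_of_continuity hC ⟨X⟩

end Summit.RiemannHypothesis.RiemannHypothesis.Theorems.MotivicDoor.AWS
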